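import Mathlib
import Summits.NavierStokesRegularity.NavierStokesRegularity.Theorems.EulerZoomLiouvillePowerGaugeEulerLiouvilleWeakSupportDensityBootstrap
import Summits.NavierStokesRegularity.NavierStokesRegularity.Theorems.EulerZoomLiouvillePowerGaugeEulerLiouvilleMomentFloorGlue
import Summits.NavierStokesRegularity.NavierStokesRegularity.Theorems.EulerZoomLiouvillePowerGaugeEulerLiouvilleMomentFloorTools
import Literature.Analysis.FluidPDE.VorticityCalculus
import HarnessLib

/-!
# THE FLOOR, ASSEMBLED: `TwoSidedMomentLaw ρ V → SupportDensityFloor ρ V → MomentFloorLaw ρ V`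
# (nsreg-p2 ROUND-53 «THE FLOOR» v1.2, plate t57-F3, route (P2)–(P5) of ROUND-53.md §1; the R53 faces BY NAME from ezl-w2 g6's `…MomentFloorGlue` (p705397);
# seat ns-ezl-w3 g8, `--supports stmt-NavierStokesRegularity-19832 --as helper`)

The class-free glue of THE FLOOR. Inputs, both as HYPOTHESES in their typed form (they are the plates t57-F1 = ns-sfl-p1 lineage and t57-F3a = LEAD 19832):
(F1) `TwoSidedMomentLaw ρ V` — for every compactly supported `C¹` weight `g` and `q₀ < 1` ONE constant `C` such that for all `q ∈ (0,q₀]` the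
normalised weighted moment `m_g^{(q)}(R) = R^{q(2+ρ)−3}∫ g(R⁻¹y)‖Ω‖^q` has a limit `L(q,g)` with `|m_g^{(q)}(R) − L| ≤ C·R^{−(1−q₀)(1+ρ/2)}` (`R ≥ 1`);
(F3a) `SupportDensityFloor ρ V` — `vol({Ω ≠ 0} ∩ B_R) ≥ c₀R³` for `R ≥ R₀` when `Ω = curl V ≢ 0`.
Output: (F3) `MomentFloorLaw ρ V` — `∫_{B_R}‖Ω‖^q ≥ ℓ·R^{3−q(2+ρ)}` for all large `R`, every `q ∈ (0,1)`.

* `MomentFloor.tendsto_weightedMoment_nhdsGT_zero` — (P2) at a FIXED scale: for a continuous field `Ω` and a continuous compactly supported weight `w`,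
  `∫ w‖Ω‖^q → ∫ w·𝟙_{Ω≠0}` as `q ↓ 0` (dominated convergence: `‖Ω‖^q → 𝟙_{Ω≠0}` pointwise, `0^q = 0`, `‖Ω‖^q ≤ 1 + ‖Ω‖` for `q ≤ 1`);
* `MomentFloor.weightedMoment_holder` — (P4) Hölder in the weight measure: `∫ w‖Ω‖^{q₁} ≤ (∫ w)^{1−q₁/q₂}(∫ w‖Ω‖^{q₂})^{q₁/q₂}` (`0 < q₁ < q₂`, `w ≥ 0`);
* ★ `MomentFloor.momentFloorLaw_of_twoSided_of_supportFloor (hρ : 0 < ρ)` — THE ASSEMBLY: with the bump `g = f₀(= 1 on B₁, 0 off B₂)`, F1 at `q₀ = q`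
  gives `C`, `δ = (1−q)(1+ρ/2)`; choose `R₁ ≥ R₀, 1` with `C R₁^{−δ} ≤ c₀/8`; (P2) + F3a give `m^{(q′)}(R₁) > c₀/2` for some `q′ ∈ (0,q)`; the uniform rate gives
  `L(q′) ≥ 3c₀/8` and `m^{(q′)}(R) ≥ c₀/4` for all `R ≥ R₁` (P3); Hölder-up at EVERY `R` (normalised: `m^{(q′)} ≤ (8v₁)^{1−q′/q}(m^{(q)})^{q′/q}`, mass of
  `f₀(R⁻¹·)` `≤ vol B_{2R} = 8v₁R³`) gives `m^{(q)}(R) ≥ κ > 0` (P4); and `∫_{B_{2R}}‖Ω‖^q ≥ ∫ f₀(R⁻¹y)‖Ω‖^q = R^{3−q(2+ρ)}m^{(q)}(R)` (P5).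

HONEST FRAMING: class-free real analysis about HYPOTHETICAL profiles (instrument-level: a two-sided portrait law; kills nothing by itself); the inputs F1/F3a
are hypotheses here and land separately; nothing about the crux E (`PowerGaugeEulerLiouville`, stmt 19832, OPEN) or NS regularity is proved; not E. [nsreg-p2 R53 §1 (P2)–(P5); folklore]
-/

noncomputable section

set_option linter.dupNamespace false

open MeasureTheory Set Filter Topology Metric Function TopologicalSpace
open scoped ENNReal NNReal RealInnerProductSpace Topology

namespace Summit.NavierStokesRegularity.NavierStokesRegularity.Theorems.PowerGaugeEulerLiouville

open Literature.Analysis Literature.Analysis.FluidPDE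

namespace MomentFloor

/-! ## (P2) The fixed-scale limit `q ↓ 0` and (P4) Hölder in the weight measure -/

section Weighted

variable {Ω : EuclideanSpace ℝ (Fin 3) → EuclideanSpace ℝ (Fin 3)} {w : EuclideanSpace ℝ (Fin 3) → ℝ}

/-- A continuous compactly supported weight times a power `q ≥ 0` of the norm of a continuous field is integrable. [folklore] -/
theorem integrable_weight_mul_norm_rpow (hw : Continuous w) (hwc : HasCompactSupport w) (hΩ : Continuous Ω) {q : ℝ} (hq : 0 ≤ q) :
    Integrable (fun y => w y * ‖Ω y‖ ^ q) :=
  (hw.mul (hΩ.norm.rpow_const fun _ => Or.inr hq)).integrable_of_hasCompactSupport hwc.mul_right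

/-- **(P2) THE FIXED-SCALE LIMIT `q ↓ 0`**: for a continuous field `Ω` and a continuous compactly supported weight `w`,
`∫ w(y)‖Ω(y)‖^q dy → ∫ w(y)·𝟙_{Ω(y)≠0} dy` as `q ↓ 0` — dominated convergence on the support of `w`: `‖Ω‖^q → 𝟙_{Ω≠0}` pointwise
(`0^q = 0` for `q > 0`, `t^q → 1` for `t > 0`) and `‖Ω‖^q ≤ 1 + ‖Ω‖` for `0 < q ≤ 1`. [nsreg-p2 R53 §1 (P2); folklore] -/
theorem tendsto_weightedMoment_nhdsGT_zero (hw : Continuous w) (hwc : HasCompactSupport w) (hΩ : Continuous Ω) :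
    Tendsto (fun q : ℝ => ∫ y, w y * ‖Ω y‖ ^ q) (𝓝[>] 0)
      (𝓝 (∫ y, w y * (if Ω y = 0 then (0 : ℝ) else 1))) := by
  have hq01 : ∀ᶠ q : ℝ in 𝓝[>] 0, q ∈ Ioo (0 : ℝ) 1 := Ioo_mem_nhdsGT one_pos
  refine tendsto_integral_filter_of_dominated_convergence (fun y => |w y| * (1 + ‖Ω y‖)) ?_ ?_ ?_ ?_
  · filter_upwards [hq01] with q hq
    exact ((hw.mul (hΩ.norm.rpow_const fun _ => Or.inr hq.1.le)).aestronglyMeasurable)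
  · filter_upwards [hq01] with q hq
    refine ae_of_all _ fun y => ?_
    rw [Real.norm_eq_abs, abs_mul, abs_of_nonneg (Real.rpow_nonneg (norm_nonneg _) q)]
    refine mul_le_mul_of_nonneg_left ?_ (abs_nonneg _)
    rcases le_or_gt ‖Ω y‖ 1 with h1 | h1
    · have : ‖Ω y‖ ^ q ≤ 1 := Real.rpow_le_one (norm_nonneg _) h1 hq.1.le
      linarith [norm_nonneg (Ω y)]
    · have : ‖Ω y‖ ^ q ≤ ‖Ω y‖ ^ (1 : ℝ) := Real.rpow_le_rpow_of_exponent_le h1.le hq.2.le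
      rw [Real.rpow_one] at this
      linarith
  · exact (hw.abs.mul (continuous_const.add hΩ.norm)).integrable_of_hasCompactSupport hwc.abs.mul_right
  · refine ae_of_all _ fun y => ?_
    by_cases hy : Ω y = 0
    · simp only [hy, norm_zero, if_true, mul_zero]
      refine (tendsto_const_nhds (x := (0 : ℝ))).congr' ?_
      filter_upwards [hq01] with q hq
      rw [Real.zero_rpow hq.1.ne', mul_zero]
    · simp only [hy, if_false, mul_one]
      have hpos : ‖Ω y‖ ≠ 0 := norm_ne_zero_iff.2 hy
      have h1 : Tendsto (fun q : ℝ => ‖Ω y‖ ^ q) (𝓝 0) (𝓝 (‖Ω y‖ ^ (0 : ℝ))) :=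
        (Real.continuousAt_const_rpow hpos).tendsto
      rw [Real.rpow_zero] at h1
      have h2 := (tendsto_nhdsWithin_of_tendsto_nhds h1 : Tendsto (fun q : ℝ => ‖Ω y‖ ^ q) (𝓝[>] 0) (𝓝 1))
      simpa using h2.const_mul (w y)

/-- **(P4) HÖLDER IN THE WEIGHT MEASURE** (Lyapunov interpolation): for `w ≥ 0` continuous compactly supported, `Ω` continuous and `0 < q₁ < q₂`,
`∫ w‖Ω‖^{q₁} ≤ (∫ w)^{1 − q₁/q₂}·(∫ w‖Ω‖^{q₂})^{q₁/q₂}` — Hölder for `w^{1−θ}·(w^{θ}‖Ω‖^{q₁})`, `θ = q₁/q₂`. Read in reverse it carries a floor of a LOW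
moment UP to every higher order. [nsreg-p2 R53 §1 (P4); folklore] -/
theorem weightedMoment_holder (hw0 : ∀ y, 0 ≤ w y) (hw : Continuous w) (hwc : HasCompactSupport w) (hΩ : Continuous Ω)
    {q₁ q₂ : ℝ} (hq₁ : 0 < q₁) (hq₁₂ : q₁ < q₂) :
    ∫ y, w y * ‖Ω y‖ ^ q₁ ≤ (∫ y, w y) ^ (1 - q₁ / q₂) * (∫ y, w y * ‖Ω y‖ ^ q₂) ^ (q₁ / q₂) := by
  have hq₂ : 0 < q₂ := hq₁.trans hq₁₂
  set θ : ℝ := q₁ / q₂ with hθdef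
  have hθ : 0 < θ := div_pos hq₁ hq₂
  have hθ1 : θ < 1 := (div_lt_one hq₂).2 hq₁₂
  have hPQ : (1 - θ)⁻¹.HolderConjugate θ⁻¹ := Real.HolderConjugate.inv_inv (by linarith) hθ (by ring)
  -- the two factors
  set F : EuclideanSpace ℝ (Fin 3) → ℝ := fun y => w y ^ (1 - θ) with hFdef
  set G : EuclideanSpace ℝ (Fin 3) → ℝ := fun y => w y ^ θ * ‖Ω y‖ ^ q₁ with hGdef
  have hF0 : ∀ y, 0 ≤ F y := fun y => Real.rpow_nonneg (hw0 y) _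
  have hG0 : ∀ y, 0 ≤ G y := fun y => mul_nonneg (Real.rpow_nonneg (hw0 y) _) (Real.rpow_nonneg (norm_nonneg _) _)
  have hFc : Continuous F := hw.rpow_const fun _ => Or.inr (by linarith)
  have hGc : Continuous G := (hw.rpow_const fun _ => Or.inr hθ.le).mul (hΩ.norm.rpow_const fun _ => Or.inr hq₁.le)
  have hsuppF : HasCompactSupport F := by
    refine hwc.mono fun y hy => ?_
    rw [mem_support] at hy ⊢
    contrapose! hy
    simp only [hFdef, hy, Real.zero_rpow (by linarith : (1 - θ) ≠ 0)]
  have hsuppG : HasCompactSupport G := by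
    refine hwc.mono fun y hy => ?_
    rw [mem_support] at hy ⊢
    contrapose! hy
    simp only [hGdef, hy, Real.zero_rpow hθ.ne', zero_mul]
  have hFmem : MemLp F (ENNReal.ofReal (1 - θ)⁻¹) volume := hFc.memLp_of_hasCompactSupport hsuppF
  have hGmem : MemLp G (ENNReal.ofReal θ⁻¹) volume := hGc.memLp_of_hasCompactSupport hsuppG
  have hH := integral_mul_le_Lp_mul_Lq_of_nonneg hPQ (ae_of_all _ hF0) (ae_of_all _ hG0) hFmem hGmem
  -- identify the three integrands
  have e1 : ∀ y, F y * G y = w y * ‖Ω y‖ ^ q₁ := by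
    intro y
    simp only [hFdef, hGdef]
    rw [← mul_assoc, ← Real.rpow_add' (hw0 y) (by linarith : (1 - θ) + θ ≠ 0), show (1 - θ) + θ = 1 by ring, Real.rpow_one]
  have e2 : ∀ y, F y ^ (1 - θ)⁻¹ = w y := by
    intro y
    simp only [hFdef]
    rw [← Real.rpow_mul (hw0 y), mul_inv_cancel₀ (by linarith : (1 - θ) ≠ 0), Real.rpow_one]
  have e3 : ∀ y, G y ^ θ⁻¹ = w y * ‖Ω y‖ ^ q₂ := by
    intro y
    simp only [hGdef]
    rw [Real.mul_rpow (Real.rpow_nonneg (hw0 y) _) (Real.rpow_nonneg (norm_nonneg _) _), ← Real.rpow_mul (hw0 y),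
      mul_inv_cancel₀ hθ.ne', Real.rpow_one, ← Real.rpow_mul (norm_nonneg _)]
    congr 2
    rw [hθdef]; field_simp
  simp_rw [e1, e2, e3, one_div, inv_inv] at hH
  exact hH

end Weighted

/-! ## THE ASSEMBLY (P2)–(P5) -/

/-- ★ **THE FLOOR from the two-sided law and the support-density floor** (`ρ > 0`; t57-F3 of nsreg-p2 ROUND-53):
`TwoSidedMomentLaw ρ V → SupportDensityFloor ρ V → MomentFloorLaw ρ V`, the three R53 faces BY NAME (`…MomentFloorGlue`, = r53/Sketch53.lean 8300150c723efd46 §A).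
For a `C²` self-similar Euler profile (`γ = 1/(2+ρ)`, centre `0`) of the budget class with `curl V ≢ 0` and every `q ∈ (0,1)`:
`∫_{B_R}‖curl V‖^q ≥ ℓ·R^{3−q(2+ρ)}` for all `R ≥ R₁`, `ℓ > 0`. Route (P2)–(P5) of ROUND-53.md §1 with the bump `f₀ = ⟨1,2⟩`:
F1 at `q₀ = q` (constant `C`, rate `δ = (1−q)(1+ρ/2)`), `R₁ ≥ max(R₀,1)` with `C R₁^{−δ} ≤ c₀/8`; the fixed-scale limit (P2) at `R₁` and F3a give a
`q′ ∈ (0,q)` with `m^{(q′)}(R₁) > c₀/2`, hence `L(q′) ≥ 3c₀/8` and `m^{(q′)}(R) ≥ c₀/4` for `R ≥ R₁` (P3); the normalised Hölder-up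
`m^{(q′)}(R) ≤ (8v₁)^{1−q′/q}·m^{(q)}(R)^{q′/q}` (P4, mass of `f₀(R⁻¹·)` at most `vol B_{2R} = 8v₁R³`, `v₁ = 4π/3`) gives `m^{(q)}(R) ≥ κ`; and
`∫_{B_{2R}}‖Ω‖^q ≥ R^{3−q(2+ρ)}m^{(q)}(R)` (P5). [nsreg-p2 R53 §1; folklore] -/
theorem momentFloorLaw_of_twoSided_of_supportFloor {ρ : ℝ} (hρ : 0 < ρ)
    {V : EuclideanSpace ℝ (Fin 3) → EuclideanSpace ℝ (Fin 3)}
    (hF1 : TwoSidedMomentLaw ρ V) (hF3a : SupportDensityFloor ρ V) : MomentFloorLaw ρ V := by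
  intro P hprof hE hA hne q hq hq1
  -- ### regularity and notation
  have hV2 : ContDiff ℝ 2 V := hprof.contDiff_velocity
  have hΩc : Continuous (curl V) := (contDiff_curl (n := 1) (by exact_mod_cast hV2)).continuous
  set Ω : EuclideanSpace ℝ (Fin 3) → EuclideanSpace ℝ (Fin 3) := curl V with hΩdef
  set S : Set (EuclideanSpace ℝ (Fin 3)) := {y | curl V y ≠ 0} with hSdef
  set f₀ : ContDiffBump (0 : EuclideanSpace ℝ (Fin 3)) := ⟨1, 2, one_pos, one_lt_two⟩ with hf₀
  have hIn : f₀.rIn = 1 := rfl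
  have hOut : f₀.rOut = 2 := rfl
  have hg1 : ContDiff ℝ 1 (f₀ : EuclideanSpace ℝ (Fin 3) → ℝ) := f₀.contDiff
  have hgc : HasCompactSupport (f₀ : EuclideanSpace ℝ (Fin 3) → ℝ) := f₀.hasCompactSupport
  -- the weighted moments and their normalisation
  set I : ℝ → ℝ → ℝ := fun q' R => ∫ y, f₀ (R⁻¹ • y) * ‖curl V y‖ ^ q' with hIdef
  set m : ℝ → ℝ → ℝ := fun q' R => R ^ (q' * (2 + ρ) - 3) * I q' R with hmdef
  have hI0 : ∀ q' R, 0 ≤ I q' R := fun q' R =>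
    integral_nonneg fun y => mul_nonneg f₀.nonneg (Real.rpow_nonneg (norm_nonneg _) _)
  have hm0 : ∀ q' R, 0 < R → 0 ≤ m q' R := fun q' R hR => mul_nonneg (Real.rpow_nonneg hR.le _) (hI0 q' R)
  -- ### F1 at `q₀ = q`, the rate, `C ≥ 0`
  obtain ⟨C, hC⟩ := hF1 P hprof hE hA f₀ hg1 hgc q hq hq1
  set δ : ℝ := (1 - q) * (1 + ρ / 2) with hδdef
  have hδ : 0 < δ := mul_pos (by linarith) (by linarith)
  obtain ⟨Lq, hLq⟩ := hC q hq le_rfl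
  have hC0 : 0 ≤ C := by
    have h := hLq 1 le_rfl
    simp only [Real.one_rpow, mul_one] at h
    exact (abs_nonneg _).trans h
  -- ### F3a
  obtain ⟨c₀, R₀, hc₀, hfl⟩ := hF3a P hprof hE hA hne
  -- ### the scale `R₁`: `R₁ ≥ max R₀ 1` and `C R^{−δ} ≤ c₀/8` for all `R ≥ R₁`
  have hevR : ∀ᶠ R : ℝ in atTop, C * R ^ (-δ) ≤ c₀ / 8 := by
    have h : Tendsto (fun R : ℝ => C * R ^ (-δ)) atTop (𝓝 (C * 0)) := (tendsto_rpow_neg_atTop hδ).const_mul C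
    rw [mul_zero] at h
    exact h.eventually (Iic_mem_nhds (by positivity))
  obtain ⟨R₁, hR₁tail, hR₁ge⟩ := (hevR.and (eventually_ge_atTop (max R₀ 1))).exists
  have hR₁0 : R₀ ≤ R₁ := le_trans (le_max_left _ _) hR₁ge
  have hR₁1 : 1 ≤ R₁ := le_trans (le_max_right _ _) hR₁ge
  have hR₁pos : 0 < R₁ := by linarith
  have htail : ∀ R : ℝ, R₁ ≤ R → C * R ^ (-δ) ≤ c₀ / 8 := fun R hR =>
    (mul_le_mul_of_nonneg_left (Real.rpow_le_rpow_of_nonpos hR₁pos hR (by linarith)) hC0).trans hR₁tail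
  -- ### (P2) at `R₁`: `m^{(q')}(R₁) → R₁^{−3}·∫ f₀(R₁⁻¹y)𝟙_S ≥ c₀` as `q' ↓ 0`
  set w : EuclideanSpace ℝ (Fin 3) → ℝ := fun y => f₀ (R₁⁻¹ • y) with hwdef
  have hw : Continuous w := (WeakEulerian.contDiff_dil f₀ R₁ (n := 0)).continuous
  have hwc : HasCompactSupport w := WeakEulerian.hasCompactSupport_dil f₀ hR₁pos
  set J₀ : ℝ := ∫ y, w y * (if curl V y = 0 then (0 : ℝ) else 1) with hJ₀def
  have hlimI : Tendsto (fun q' : ℝ => I q' R₁) (𝓝[>] 0) (𝓝 J₀) := tendsto_weightedMoment_nhdsGT_zero hw hwc hΩc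
  -- `J₀ ≥ vol(S ∩ B_{R₁}) ≥ c₀ R₁³`
  have hSm : MeasurableSet (S ∩ ball (0 : EuclideanSpace ℝ (Fin 3)) R₁) :=
    ((isOpen_ne_fun hΩc continuous_const).measurableSet).inter measurableSet_ball
  have hJ₀ge : (volume (S ∩ ball (0 : EuclideanSpace ℝ (Fin 3)) R₁)).toReal ≤ J₀ := by
    have hfin : volume (S ∩ ball (0 : EuclideanSpace ℝ (Fin 3)) R₁) ≠ ⊤ :=
      measure_ne_top_of_subset inter_subset_right measure_ball_lt_top.ne
    have e : (volume (S ∩ ball (0 : EuclideanSpace ℝ (Fin 3)) R₁)).toReal =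
        ∫ y, (S ∩ ball (0 : EuclideanSpace ℝ (Fin 3)) R₁).indicator (fun _ => (1 : ℝ)) y := by
      rw [integral_indicator hSm, setIntegral_const, smul_eq_mul, mul_one, measureReal_def]
    rw [e]
    have hint1 : Integrable (fun y => (S ∩ ball (0 : EuclideanSpace ℝ (Fin 3)) R₁).indicator (fun _ => (1 : ℝ)) y) :=
      (integrable_indicator_iff hSm).2 (integrableOn_const hfin)
    have hint2 : Integrable (fun y => w y * (if curl V y = 0 then (0 : ℝ) else 1)) := by
      refine Integrable.mono' ((hw.integrable_of_hasCompactSupport hwc).norm) ?_ (ae_of_all _ fun y => ?_)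
      · refine (hw.aestronglyMeasurable.mul ?_)
        have hm : Measurable fun y => if curl V y = 0 then (0 : ℝ) else 1 :=
          Measurable.ite (hΩc.measurable (measurableSet_singleton 0)) measurable_const measurable_const
        exact hm.aestronglyMeasurable
      · rw [Real.norm_eq_abs, Real.norm_eq_abs, abs_mul]
        by_cases h : curl V y = 0
        · simp [h]
        · simp [h]
    refine integral_mono hint1 hint2 fun y => ?_
    by_cases hy : y ∈ S ∩ ball (0 : EuclideanSpace ℝ (Fin 3)) R₁
    · rw [indicator_of_mem hy]
      have hne' : curl V y ≠ 0 := hy.1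
      have hyb : ‖y‖ ≤ f₀.rIn * R₁ := by
        rw [hIn, one_mul]; exact le_of_lt (mem_ball_zero_iff.1 hy.2)
      simp only [hne', if_false, mul_one, hwdef]
      exact (WeakEulerian.dil_eq_one f₀ hR₁pos hyb).symm.le
    · rw [indicator_of_notMem hy]
      by_cases h : curl V y = 0
      · simp [h]
      · simp only [h, if_false, mul_one]; exact f₀.nonneg
  have hJ₀ : c₀ * R₁ ^ (3 : ℝ) ≤ J₀ := (hfl R₁ hR₁0).trans hJ₀ge
  -- the prefactor `R₁^{q'(2+ρ)−3} → R₁^{−3}`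
  have hpref : Tendsto (fun q' : ℝ => R₁ ^ (q' * (2 + ρ) - 3)) (𝓝[>] 0) (𝓝 (R₁ ^ (-(3 : ℝ)))) := by
    have hc : Continuous fun q' : ℝ => R₁ ^ (q' * (2 + ρ) - 3) :=
      (Real.continuous_const_rpow hR₁pos.ne').comp ((continuous_id.mul continuous_const).sub continuous_const)
    have h := hc.tendsto 0
    simp only [zero_mul, zero_sub] at h
    exact tendsto_nhdsWithin_of_tendsto_nhds h
  have hlimm : Tendsto (fun q' : ℝ => m q' R₁) (𝓝[>] 0) (𝓝 (R₁ ^ (-(3 : ℝ)) * J₀)) := hpref.mul hlimI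
  have hmlim : c₀ ≤ R₁ ^ (-(3 : ℝ)) * J₀ := by
    have h3 : R₁ ^ (-(3 : ℝ)) * (c₀ * R₁ ^ (3 : ℝ)) = c₀ := by
      rw [Real.rpow_neg hR₁pos.le]; field_simp
    calc c₀ = R₁ ^ (-(3 : ℝ)) * (c₀ * R₁ ^ (3 : ℝ)) := h3.symm
      _ ≤ R₁ ^ (-(3 : ℝ)) * J₀ := mul_le_mul_of_nonneg_left hJ₀ (Real.rpow_nonneg hR₁pos.le _)
  -- pick `q' ∈ (0, q)` with `m^{(q')}(R₁) > c₀/2`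
  have hev1 : ∀ᶠ q' : ℝ in 𝓝[>] 0, c₀ / 2 < m q' R₁ := hlimm.eventually (lt_mem_nhds (by linarith))
  have hev2 : ∀ᶠ q' : ℝ in 𝓝[>] 0, q' ∈ Ioo (0 : ℝ) q := Ioo_mem_nhdsGT hq
  obtain ⟨q', hq'm, hq'I⟩ := (hev1.and hev2).exists
  have hq' : 0 < q' := hq'I.1
  have hq'q : q' < q := hq'I.2
  -- ### (P3) the floor of the normalised `q'`-moment on `[R₁, ∞)`
  obtain ⟨L', hL'⟩ := hC q' hq' hq'q.le
  have hL'ge : 3 * c₀ / 8 ≤ L' := by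
    have h1 := hL' R₁ hR₁1
    have h2 := htail R₁ le_rfl
    have h3 := (abs_le.1 (h1.trans h2)).2
    change m q' R₁ - L' ≤ c₀ / 8 at h3
    linarith
  have hfloor' : ∀ R : ℝ, R₁ ≤ R → c₀ / 4 ≤ m q' R := by
    intro R hR
    have h1 := hL' R (le_trans hR₁1 hR)
    have h2 := htail R hR
    have h3 := (abs_le.1 (h1.trans h2)).1
    change -(c₀ / 8) ≤ m q' R - L' at h3
    linarith
  -- ### (P4) Hölder-up at every `R ≥ R₁`, normalised
  set v₁ : ℝ := Real.pi * 4 / 3 with hv₁def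
  have hv₁ : 0 < v₁ := by rw [hv₁def]; positivity
  set θ : ℝ := q' / q with hθdef
  have hθ : 0 < θ := div_pos hq' hq
  have hθ1 : θ < 1 := (div_lt_one hq).2 hq'q
  -- mass of the dilated bump: `∫ f₀(R⁻¹y) ≤ vol(B_{2R}) = 8 v₁ R³`
  have hmass : ∀ R : ℝ, 0 < R → ∫ y, f₀ (R⁻¹ • y) ≤ 8 * v₁ * R ^ (3 : ℕ) := by
    intro R hR
    have hind : ∀ y, f₀ (R⁻¹ • y) ≤ (ball (0 : EuclideanSpace ℝ (Fin 3)) (2 * R)).indicator (fun _ => (1 : ℝ)) y := by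
      intro y
      by_cases hy : y ∈ ball (0 : EuclideanSpace ℝ (Fin 3)) (2 * R)
      · rw [indicator_of_mem hy]; exact f₀.le_one
      · rw [indicator_of_notMem hy]
        rw [mem_ball_zero_iff, not_lt] at hy
        exact (WeakEulerian.dil_eq_zero f₀ hR (by rw [hOut]; exact hy)).le
    have hint : Integrable (fun y => (ball (0 : EuclideanSpace ℝ (Fin 3)) (2 * R)).indicator (fun _ => (1 : ℝ)) y) :=
      (integrable_indicator_iff measurableSet_ball).2 (integrableOn_const measure_ball_lt_top.ne)
    calc ∫ y, f₀ (R⁻¹ • y) ≤ ∫ y, (ball (0 : EuclideanSpace ℝ (Fin 3)) (2 * R)).indicator (fun _ => (1 : ℝ)) y :=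
          integral_mono ((WeakEulerian.contDiff_dil f₀ R (n := 0)).continuous.integrable_of_hasCompactSupport
            (WeakEulerian.hasCompactSupport_dil f₀ hR)) hint hind
      _ = (volume (ball (0 : EuclideanSpace ℝ (Fin 3)) (2 * R))).toReal := by
          rw [integral_indicator measurableSet_ball, setIntegral_const, smul_eq_mul, mul_one, measureReal_def]
      _ = 8 * v₁ * R ^ (3 : ℕ) := by rw [WeakEulerian.volume_ball_toReal (by linarith)]; ring
  have hup : ∀ R : ℝ, R₁ ≤ R → m q' R ≤ (8 * v₁) ^ (1 - θ) * (m q R) ^ θ := by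
    intro R hR
    have hR0 : 0 < R := by linarith
    have hwR : Continuous fun y : EuclideanSpace ℝ (Fin 3) => f₀ (R⁻¹ • y) := (WeakEulerian.contDiff_dil f₀ R (n := 0)).continuous
    have hwRc : HasCompactSupport fun y : EuclideanSpace ℝ (Fin 3) => f₀ (R⁻¹ • y) := WeakEulerian.hasCompactSupport_dil f₀ hR0
    -- Hölder: `I q' R ≤ (∫ f₀_R)^{1−θ} (I q R)^θ ≤ (8v₁R³)^{1−θ} (I q R)^θ`
    have hH := weightedMoment_holder (fun y => f₀.nonneg) hwR hwRc hΩc hq' hq'q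
    have hH' : I q' R ≤ (8 * v₁ * R ^ (3 : ℕ)) ^ (1 - θ) * (I q R) ^ θ := by
      refine hH.trans (mul_le_mul_of_nonneg_right ?_ (Real.rpow_nonneg (hI0 q R) _))
      exact Real.rpow_le_rpow (integral_nonneg fun y => f₀.nonneg) (hmass R hR0) (by linarith)
    -- normalise: multiply by `R^{q'(2+ρ)−3}` and redistribute the powers of `R`
    have hsplit : R ^ (q' * (2 + ρ) - 3) * ((8 * v₁ * R ^ (3 : ℕ)) ^ (1 - θ) * (I q R) ^ θ) =
        (8 * v₁) ^ (1 - θ) * (m q R) ^ θ := by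
      rw [hmdef]
      simp only
      rw [Real.mul_rpow (by positivity : (0 : ℝ) ≤ 8 * v₁) (pow_nonneg hR0.le 3),
        Real.mul_rpow (Real.rpow_nonneg hR0.le _) (hI0 q R), ← Real.rpow_natCast R 3,
        ← Real.rpow_mul hR0.le, ← Real.rpow_mul hR0.le]
      have hexp : R ^ (q' * (2 + ρ) - 3) * R ^ (((3 : ℕ) : ℝ) * (1 - θ)) = R ^ ((q * (2 + ρ) - 3) * θ) := by
        rw [← Real.rpow_add hR0]
        congr 1
        have hqne : q ≠ 0 := hq.ne'
        rw [hθdef]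
        push_cast
        field_simp
        ring
      calc R ^ (q' * (2 + ρ) - 3) * ((8 * v₁) ^ (1 - θ) * R ^ (((3 : ℕ) : ℝ) * (1 - θ)) * (I q R) ^ θ)
          = (8 * v₁) ^ (1 - θ) * ((R ^ (q' * (2 + ρ) - 3) * R ^ (((3 : ℕ) : ℝ) * (1 - θ))) * (I q R) ^ θ) := by ring
        _ = (8 * v₁) ^ (1 - θ) * (R ^ ((q * (2 + ρ) - 3) * θ) * (I q R) ^ θ) := by rw [hexp]
    calc m q' R = R ^ (q' * (2 + ρ) - 3) * I q' R := rfl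
      _ ≤ R ^ (q' * (2 + ρ) - 3) * ((8 * v₁ * R ^ (3 : ℕ)) ^ (1 - θ) * (I q R) ^ θ) :=
          mul_le_mul_of_nonneg_left hH' (Real.rpow_nonneg hR0.le _)
      _ = (8 * v₁) ^ (1 - θ) * (m q R) ^ θ := hsplit
  -- the constant `κ`: `m q R ≥ κ` for `R ≥ R₁`
  set κ : ℝ := (c₀ / 4 / (8 * v₁) ^ (1 - θ)) ^ θ⁻¹ with hκdef
  have h8 : 0 < (8 * v₁) ^ (1 - θ) := Real.rpow_pos_of_pos (by positivity) _
  have hκ : 0 < κ := Real.rpow_pos_of_pos (div_pos (by positivity) h8) _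
  have hmq : ∀ R : ℝ, R₁ ≤ R → κ ≤ m q R := by
    intro R hR
    have hR0 : 0 < R := by linarith
    have h1 : c₀ / 4 ≤ (8 * v₁) ^ (1 - θ) * (m q R) ^ θ := (hfloor' R hR).trans (hup R hR)
    have h2 : c₀ / 4 / (8 * v₁) ^ (1 - θ) ≤ (m q R) ^ θ := by
      rw [div_le_iff₀ h8]; linarith
    have h3 := Real.rpow_le_rpow (div_nonneg (by positivity) h8.le) h2 (inv_pos.2 hθ).le
    rwa [Real.rpow_rpow_inv (hm0 q R hR0) hθ.ne'] at h3
  -- ### (P5) sharp balls: `∫_{B_{2R}}‖Ω‖^q ≥ I q R = R^{3−q(2+ρ)} m q R ≥ κ R^{3−q(2+ρ)}`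
  have hball : ∀ R : ℝ, 0 < R → I q R ≤ ∫ y in ball (0 : EuclideanSpace ℝ (Fin 3)) (2 * R), ‖curl V y‖ ^ q := by
    intro R hR
    have hind : ∀ y, f₀ (R⁻¹ • y) * ‖curl V y‖ ^ q ≤
        (ball (0 : EuclideanSpace ℝ (Fin 3)) (2 * R)).indicator (fun y => ‖curl V y‖ ^ q) y := by
      intro y
      by_cases hy : y ∈ ball (0 : EuclideanSpace ℝ (Fin 3)) (2 * R)
      · rw [indicator_of_mem hy]
        exact mul_le_of_le_one_left (Real.rpow_nonneg (norm_nonneg _) _) f₀.le_one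
      · rw [indicator_of_notMem hy]
        rw [mem_ball_zero_iff, not_lt] at hy
        rw [WeakEulerian.dil_eq_zero f₀ hR (by rw [hOut]; exact hy), zero_mul]
    have hintq : IntegrableOn (fun y => ‖curl V y‖ ^ q) (ball (0 : EuclideanSpace ℝ (Fin 3)) (2 * R)) :=
      ((hΩc.norm.rpow_const fun _ => Or.inr hq.le).continuousOn.integrableOn_compact
        (isCompact_closedBall (0 : EuclideanSpace ℝ (Fin 3)) (2 * R))).mono_set ball_subset_closedBall
    calc I q R ≤ ∫ y, (ball (0 : EuclideanSpace ℝ (Fin 3)) (2 * R)).indicator (fun y => ‖curl V y‖ ^ q) y :=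
          integral_mono (integrable_weight_mul_norm_rpow
            (WeakEulerian.contDiff_dil f₀ R (n := 0)).continuous (WeakEulerian.hasCompactSupport_dil f₀ hR) hΩc hq.le)
            ((integrable_indicator_iff measurableSet_ball).2 hintq) hind
      _ = ∫ y in ball (0 : EuclideanSpace ℝ (Fin 3)) (2 * R), ‖curl V y‖ ^ q := integral_indicator measurableSet_ball
  refine ⟨κ * (1 / 2) ^ (3 - q * (2 + ρ)), 2 * R₁, by positivity, fun R' hR' => ?_⟩
  have hR'0 : 0 < R' := by linarith
  set R : ℝ := R' / 2 with hRdef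
  have hRR₁ : R₁ ≤ R := by rw [hRdef]; linarith
  have hR0 : 0 < R := by linarith
  have h1 : κ * R ^ (3 - q * (2 + ρ)) ≤ I q R := by
    have hm := hmq R hRR₁
    have e : I q R = R ^ (3 - q * (2 + ρ)) * m q R := by
      rw [hmdef]
      simp only
      rw [← mul_assoc, ← Real.rpow_add hR0, show 3 - q * (2 + ρ) + (q * (2 + ρ) - 3) = 0 by ring, Real.rpow_zero, one_mul]
    rw [e, mul_comm]
    exact mul_le_mul_of_nonneg_left hm (Real.rpow_nonneg hR0.le _)
  have h2 : (2 : ℝ) * R = R' := by rw [hRdef]; ring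
  calc κ * (1 / 2) ^ (3 - q * (2 + ρ)) * R' ^ (3 - q * (2 + ρ)) = κ * R ^ (3 - q * (2 + ρ)) := by
        rw [mul_assoc, ← Real.mul_rpow (by norm_num : (0 : ℝ) ≤ 1 / 2) hR'0.le, hRdef]
        congr 2; ring
    _ ≤ I q R := h1
    _ ≤ ∫ y in ball (0 : EuclideanSpace ℝ (Fin 3)) (2 * R), ‖curl V y‖ ^ q := hball R hR0
    _ = ∫ y in ball (0 : EuclideanSpace ℝ (Fin 3)) R', ‖curl V y‖ ^ q := by rw [h2]

end MomentFloor

end Summit.NavierStokesRegularity.NavierStokesRegularity.Theorems.PowerGaugeEulerLiouville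

end
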